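import Summits.Langlands.Langlands.Theses.ParityBlindBianchi

/-!
# `IcosahedralDescentLevel` (stmt-Langlands-15113) absorbs the target through the junk bad set `S₀ = {0}`

Negative-side lemma (refuter crux attack, 2026-08-16; supports stmt-Langlands-15113).

The hypothesis of `ParityBlindBianchi.IcosahedralDescentLevel` (D′) binds `∃ S₀ : Finset ℕ` with no
side condition, and calls a place `w` of `K` good iff `∀ ℓ ∈ S₀, ((ℓ : ℕ) : 𝓞 K) ∉ w.asIdeal`.
Since `((0 : ℕ) : 𝓞 K) = 0` lies in every ideal, NO place is good once `0 ∈ S₀`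
(`no_good_place_of_zero_mem`), so the Satake–Frobenius compatibility clause of the hypothesis is
vacuous there and the hypothesis degenerates to "a 2-adic model of `ρ|_K` and SOME cuspidal `π_K`
exist for every 2-split imaginary quadratic `K`" — data that `ResidualBianchiDoorLevel` (E1′)
already provides and that say nothing about `ρ`. Consequently E1′ and D′ ALONE yield strong Artin
(a.e., Tunnell's sense) for EVERY irreducible `ρ : Γ_ℚ → GL₂(ℂ)` with projective image `A₅`, odd or
even (`allParity_of_door_of_descent`): the crux D′, filed as theorem-sized uniform quadratic
descent of difficulty M, is as typed at least as strong as the route's rank-0 target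
`EvenIcosahedralStrongArtin` (open), and the open-problem cruxes E2′/R′ are bypassed.

Repair recorded on the item (refuted-misstated): `∃ S₀ : Finset ℕ, 0 ∉ S₀ ∧ ∀ K …` in D′ and
`∃ S₀, 2 ∈ S₀ ∧ 0 ∉ S₀ ∧ …` in E1′; the witness `S₀ = {0}` misses the repaired statements.
-/

namespace Summit.Langlands.Langlands.Theorems.IcosahedralDescentLevel.Negative

open Summit.Langlands.Langlands.Theses.ParityBlindBianchi

/-- With `0 ∈ S₀` the route's "good place" predicate `∀ ℓ ∈ S₀, ((ℓ : ℕ) : 𝓞 K) ∉ w.asIdeal` is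
unsatisfiable: no finite place of `K` is good (`(0 : 𝓞 K) ∈ w.asIdeal`). [folklore] -/
theorem no_good_place_of_zero_mem {S₀ : Finset ℕ} (h0 : (0 : ℕ) ∈ S₀)
    (K : Type) [Field K] [NumberField K]
    (w : IsDedekindDomain.HeightOneSpectrum (NumberField.RingOfIntegers K)) :
    ¬ (∀ ℓ ∈ S₀, ((ℓ : ℕ) : NumberField.RingOfIntegers K) ∉ w.asIdeal) :=
  fun h => h 0 h0 (by simp)

/-- **E1′ and D′ alone give all-parity icosahedral strong Artin over `ℚ` (a.e.).** For every
`ι : ℚ̄₂ ≃+* ℂ` and every irreducible `ρ : Γ_ℚ → GL₂(ℂ)` with projective image `A₅` — NO parity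
hypothesis — `ResidualBianchiDoorLevel` and `IcosahedralDescentLevel` produce a cuspidal `π` of
`GL₂(𝔸_ℚ)` whose Satake polynomial is `charpoly ρ(Frob_v)` at cofinitely many `v`: feed D′ with the
junk bad set `S₀ = {0}` (no good places, vacuous compatibility) and the models/cuspidal data of E1′.
Shows that D′ as typed carries the route's open target (and the odd case) by itself. [folklore] -/
theorem allParity_of_door_of_descent (hE1 : ResidualBianchiDoorLevel)
    (hD : IcosahedralDescentLevel) (ι : PadicAlgCl 2 ≃+* ℂ)
    (ρ : Literature.NumberTheory.GaloisRepresentations.FramedGaloisRep ℚ ℂ 2)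
    (hirr : ρ.toGaloisRep.IsIrreducible)
    (hA5 : Nonempty ((Matrix.ProjGenLinGroup.mk.comp ρ.toMonoidHom).range ≃*
      alternatingGroup (Fin 5))) :
    ∃ (hcpt : Literature.NumberTheory.Automorphic.isCompact_glFiniteIntegralLevel 2 ℚ)
      (π : Literature.NumberTheory.Automorphic.CuspidalAutomorphicRepData 2 ℚ hcpt),
      (∀ᶠ v : IsDedekindDomain.HeightOneSpectrum (NumberField.RingOfIntegers ℚ) in
        Filter.cofinite, ∃ α : Multiset ℂ, π.1.HasSatakeParamAt v α ∧ ρ.IsUnramifiedAt v ∧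
          ρ.HasFrobCharpolyAt v (Literature.NumberTheory.Automorphic.satakePolynomial α)) := by
  -- E1′ supplies, for every 2-split imaginary quadratic K, the 2-adic model σ and a cuspidal π₀
  obtain ⟨_S₀, -, hK⟩ := hE1 ι ρ hirr hA5
  -- feed D′ with the JUNK bad set {0}: its compatibility clause becomes vacuous
  refine hD ι ρ hirr hA5 ⟨{0}, ?_⟩
  intro K _ _ htc hdeg hsplit
  obtain ⟨σ, hmodel, -, -, -, hcpt, π₀, -, -⟩ := hK K htc hdeg hsplit
  refine ⟨σ, hcpt, π₀, hmodel, ?_⟩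
  intro w hw
  exact absurd hw (no_good_place_of_zero_mem (Finset.mem_singleton_self 0) K w)

end Summit.Langlands.Langlands.Theorems.IcosahedralDescentLevel.Negative
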